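import Summits.Ventures.WeilGRH.UniformConductorFloorCoprimeSound
import Summits.Ventures.WeilGRH.UniformConductorFloorCoprimeEvenTwoLog9Check
import Summits.Ventures.WeilGRH.UniformConductorFloorCoprimeOddTwoLog9Check
import Summits.Ventures.WeilGRH.UniformConductorFloorCoprimeEvenThreeLog9Check
import Summits.Ventures.WeilGRH.UniformConductorFloorCoprimeOddThreeLog9Check
import Summits.Ventures.WeilGRH.UniformConductorFloorCoprimeEvenSixLog9Check
import Summits.Ventures.WeilGRH.UniformConductorFloorCoprimeOddSixLog9Check
import Summits.Ventures.WeilGRH.UniformConductorFloorCoprimeInputsLog9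
import HarnessLib

/-!
# GRH arm (rh-explicit, venture WeilGRH): ★ DIVISIBILITY FLOORS at the rung `t = log 3` — Weil positivity on `[-log 3, log 3]` for EVERY
  Dirichlet character of EVERY modulus `q` with `m ∣ q`, `q ≥ q*(log 3; m)`, `m ∈ {2, 3, 6}`

Cell `rh-explicit`, WEIL TRACK — GRH ARM (weil-grh-1, gen7).  The level-`m` joint cell certificates of
`UniformConductorFloorCoprimeDataLog9.lean` (grid `R = 280`, `J = 308`, window `308 log(280/279) = 1.10197 ≥ log 3`; kernel checks
`…Coprime{Even,Odd}{Two,Three,Six}Log9Check.lean`; inputs `…CoprimeInputsLog9.lean`) through `JointCert.weilPositivityOnChar_of_le_of_parts_coprime`: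

| `m` | all `χ`: stated floor | odd `χ` |
|---|---|---|
| 1 (tree, `…JointFloorsLog9`) | 133 | 49 |
| 2 | 52 (budget 3.9439, e^· = 51.62) | 20 (2.9499, 19.10) |
| 3 | 72 (budget 4.2569, e^· = 70.59) | 27 (3.2572, 25.98) |
| 6 | 30 (budget 3.3128, e^· = 27.46) | 12 (2.3449, 10.43) |

(stated floor = the first multiple of `m` above the method floor `e^budget` whose logarithm has a two-term lower bound in `log 2`, `log 3`.)
Honest scope: finite-window statements; nothing here is a step towards GRH for any individual character; no `ζ` input; standard axioms.

## References

* A. Weil (1952), (11) pp. 261–262 and the «lemme» p. 262 [Weil1952FormulesExplicites]; L. Collatz (1942) / H. Wielandt (1950). [folklore]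
-/

noncomputable section

open Real Set
open scoped ArithmeticFunction.vonMangoldt

namespace Summit.Ventures.WeilGRH

open Literature.NumberTheory.LFunctions

namespace UniformFloor

variable {q : ℕ}

/-- ★ Every EVEN character of every modulus `q ≥ 52` with `2 ∣ q` at the rung `log 3`. [folklore] -/
theorem weilPositivityOnChar_log_three_of_even_two_dvd_ge_52 (hm : 2 ∣ q) (hq : 52 ≤ q) (χ : DirichletCharacter ℂ q)
    (hpar : charParity χ = 0) : WeilPositivityOnChar χ (Real.log 3) :=
  certEvenDvd2Log9.weilPositivityOnChar_of_le_of_parts_coprime certEvenDvd2Log9_checkFrame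
    (fun _ hj ↦ certEvenDvd2Log9.cellOKB_of_checkCells certEvenDvd2Log9_checkCells hj) certEvenDvd2Log9_hw psi_even_ge
    (Q₀ := 52) (by norm_num) certEvenDvd2Log9_budget (by omega) hm hq χ hpar (log_three_le_t_280_308 certEvenDvd2Log9 rfl rfl)

/-- ★ Every ODD character of every modulus `q ≥ 20` with `2 ∣ q` at the rung `log 3`. [cite: Weil1952FormulesExplicites, (11) and the «lemme» p. 262] -/
theorem weilPositivityOnChar_log_three_of_odd_two_dvd_ge_20 (hm : 2 ∣ q) (hq : 20 ≤ q) (χ : DirichletCharacter ℂ q)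
    (hpar : charParity χ = 1) : WeilPositivityOnChar χ (Real.log 3) :=
  certOddDvd2Log9.weilPositivityOnChar_of_le_of_parts_coprime certOddDvd2Log9_checkFrame
    (fun _ hj ↦ certOddDvd2Log9.cellOKB_of_checkCells certOddDvd2Log9_checkCells hj) certOddDvd2Log9_hw psi_odd_ge
    (Q₀ := 20) (by norm_num) certOddDvd2Log9_budget (by omega) hm hq χ hpar (log_three_le_t_280_308 certOddDvd2Log9 rfl rfl)

/-- ★★ EVERY Dirichlet character of EVERY modulus `q ≥ 52` with `2 ∣ q` satisfies `WeilPositivityOnChar χ (log 3)`.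
[cite: Weil1952FormulesExplicites, (11) and the «lemme» p. 262] -/
theorem weilPositivityOnChar_log_three_of_two_dvd_ge_52 (hm : 2 ∣ q) (hq : 52 ≤ q) (χ : DirichletCharacter ℂ q) :
    WeilPositivityOnChar χ (Real.log 3) := by
  rcases Nat.le_one_iff_eq_zero_or_eq_one.1 (charParity_le_one χ) with h | h
  · exact weilPositivityOnChar_log_three_of_even_two_dvd_ge_52 hm hq χ h
  · exact weilPositivityOnChar_log_three_of_odd_two_dvd_ge_20 hm (by omega) χ h

/-- The same on every window `t ≤ log 3`. [folklore] -/
theorem weilPositivityOnChar_of_le_log_three_of_two_dvd_ge_52 (hm : 2 ∣ q) (hq : 52 ≤ q) (χ : DirichletCharacter ℂ q)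
    {t : ℝ} (ht : t ≤ Real.log 3) : WeilPositivityOnChar χ t := fun g hg hsupp ↦
  weilPositivityOnChar_log_three_of_two_dvd_ge_52 hm hq χ g hg (hsupp.trans (Icc_subset_Icc (by linarith) ht))

/-- ★ Every EVEN character of every modulus `q ≥ 72` with `3 ∣ q` at the rung `log 3`. [folklore] -/
theorem weilPositivityOnChar_log_three_of_even_three_dvd_ge_72 (hm : 3 ∣ q) (hq : 72 ≤ q) (χ : DirichletCharacter ℂ q)
    (hpar : charParity χ = 0) : WeilPositivityOnChar χ (Real.log 3) :=
  certEvenDvd3Log9.weilPositivityOnChar_of_le_of_parts_coprime certEvenDvd3Log9_checkFrame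
    (fun _ hj ↦ certEvenDvd3Log9.cellOKB_of_checkCells certEvenDvd3Log9_checkCells hj) certEvenDvd3Log9_hw psi_even_ge
    (Q₀ := 72) (by norm_num) certEvenDvd3Log9_budget (by omega) hm hq χ hpar (log_three_le_t_280_308 certEvenDvd3Log9 rfl rfl)

/-- ★ Every ODD character of every modulus `q ≥ 27` with `3 ∣ q` at the rung `log 3`. [cite: Weil1952FormulesExplicites, (11) and the «lemme» p. 262] -/
theorem weilPositivityOnChar_log_three_of_odd_three_dvd_ge_27 (hm : 3 ∣ q) (hq : 27 ≤ q) (χ : DirichletCharacter ℂ q)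
    (hpar : charParity χ = 1) : WeilPositivityOnChar χ (Real.log 3) :=
  certOddDvd3Log9.weilPositivityOnChar_of_le_of_parts_coprime certOddDvd3Log9_checkFrame
    (fun _ hj ↦ certOddDvd3Log9.cellOKB_of_checkCells certOddDvd3Log9_checkCells hj) certOddDvd3Log9_hw psi_odd_ge
    (Q₀ := 27) (by norm_num) certOddDvd3Log9_budget (by omega) hm hq χ hpar (log_three_le_t_280_308 certOddDvd3Log9 rfl rfl)

/-- ★★ EVERY Dirichlet character of EVERY modulus `q ≥ 72` with `3 ∣ q` satisfies `WeilPositivityOnChar χ (log 3)`.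
[cite: Weil1952FormulesExplicites, (11) and the «lemme» p. 262] -/
theorem weilPositivityOnChar_log_three_of_three_dvd_ge_72 (hm : 3 ∣ q) (hq : 72 ≤ q) (χ : DirichletCharacter ℂ q) :
    WeilPositivityOnChar χ (Real.log 3) := by
  rcases Nat.le_one_iff_eq_zero_or_eq_one.1 (charParity_le_one χ) with h | h
  · exact weilPositivityOnChar_log_three_of_even_three_dvd_ge_72 hm hq χ h
  · exact weilPositivityOnChar_log_three_of_odd_three_dvd_ge_27 hm (by omega) χ h

/-- The same on every window `t ≤ log 3`. [folklore] -/
theorem weilPositivityOnChar_of_le_log_three_of_three_dvd_ge_72 (hm : 3 ∣ q) (hq : 72 ≤ q) (χ : DirichletCharacter ℂ q)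
    {t : ℝ} (ht : t ≤ Real.log 3) : WeilPositivityOnChar χ t := fun g hg hsupp ↦
  weilPositivityOnChar_log_three_of_three_dvd_ge_72 hm hq χ g hg (hsupp.trans (Icc_subset_Icc (by linarith) ht))

/-- ★ Every EVEN character of every modulus `q ≥ 30` with `6 ∣ q` at the rung `log 3`. [folklore] -/
theorem weilPositivityOnChar_log_three_of_even_six_dvd_ge_30 (hm : 6 ∣ q) (hq : 30 ≤ q) (χ : DirichletCharacter ℂ q)
    (hpar : charParity χ = 0) : WeilPositivityOnChar χ (Real.log 3) :=
  certEvenDvd6Log9.weilPositivityOnChar_of_le_of_parts_coprime certEvenDvd6Log9_checkFrame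
    (fun _ hj ↦ certEvenDvd6Log9.cellOKB_of_checkCells certEvenDvd6Log9_checkCells hj) certEvenDvd6Log9_hw psi_even_ge
    (Q₀ := 30) (by norm_num) certEvenDvd6Log9_budget (by omega) hm hq χ hpar (log_three_le_t_280_308 certEvenDvd6Log9 rfl rfl)

/-- ★ Every ODD character of every modulus `q ≥ 12` with `6 ∣ q` at the rung `log 3`. [cite: Weil1952FormulesExplicites, (11) and the «lemme» p. 262] -/
theorem weilPositivityOnChar_log_three_of_odd_six_dvd_ge_12 (hm : 6 ∣ q) (hq : 12 ≤ q) (χ : DirichletCharacter ℂ q)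
    (hpar : charParity χ = 1) : WeilPositivityOnChar χ (Real.log 3) :=
  certOddDvd6Log9.weilPositivityOnChar_of_le_of_parts_coprime certOddDvd6Log9_checkFrame
    (fun _ hj ↦ certOddDvd6Log9.cellOKB_of_checkCells certOddDvd6Log9_checkCells hj) certOddDvd6Log9_hw psi_odd_ge
    (Q₀ := 12) (by norm_num) certOddDvd6Log9_budget (by omega) hm hq χ hpar (log_three_le_t_280_308 certOddDvd6Log9 rfl rfl)

/-- ★★ EVERY Dirichlet character of EVERY modulus `q ≥ 30` with `6 ∣ q` satisfies `WeilPositivityOnChar χ (log 3)`.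
[cite: Weil1952FormulesExplicites, (11) and the «lemme» p. 262] -/
theorem weilPositivityOnChar_log_three_of_six_dvd_ge_30 (hm : 6 ∣ q) (hq : 30 ≤ q) (χ : DirichletCharacter ℂ q) :
    WeilPositivityOnChar χ (Real.log 3) := by
  rcases Nat.le_one_iff_eq_zero_or_eq_one.1 (charParity_le_one χ) with h | h
  · exact weilPositivityOnChar_log_three_of_even_six_dvd_ge_30 hm hq χ h
  · exact weilPositivityOnChar_log_three_of_odd_six_dvd_ge_12 hm (by omega) χ h

/-- The same on every window `t ≤ log 3`. [folklore] -/
theorem weilPositivityOnChar_of_le_log_three_of_six_dvd_ge_30 (hm : 6 ∣ q) (hq : 30 ≤ q) (χ : DirichletCharacter ℂ q)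
    {t : ℝ} (ht : t ≤ Real.log 3) : WeilPositivityOnChar χ t := fun g hg hsupp ↦
  weilPositivityOnChar_log_three_of_six_dvd_ge_30 hm hq χ g hg (hsupp.trans (Icc_subset_Icc (by linarith) ht))

end UniformFloor

end Summit.Ventures.WeilGRH

end
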